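import Mathlib
import Summits.NavierStokesRegularity.NavierStokesRegularity.Theorems.TaoLadderRungThreeLocalDynamicsSufficesAt
import Summits.NavierStokesRegularity.NavierStokesRegularity.Theses.TaoLadderRungTwoPoly
import HarnessLib

/-!
# `TaoLadderRungTwoPoly.LocalDynamicsSufficesAt` (item stmt-NavierStokesRegularity-20652)

The support `LocalDynamicsSufficesAt` of route `TaoLadderRungTwoPoly` is, character for character,
the shared support `LocalDynamicsSufficesAt` of routes `TaoLadderRungThree` / `TaoLadderRungTwo`
(item stmt-NavierStokesRegularity-20426), already proved in the tree via
`Theorems.LocalDynamicsSufficesAt.noGlobalCascade_of_local`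
(file `TaoLadderRungThreeLocalDynamicsSufficesAt.lean`): for `ε₀ > 0` and `R ≥ 1`,
`DynamicsLocalAt ε₀ R` yields a table `α ∈ InTableClass R` and a datum `X₀` with
`NoGlobalCascade ε₀ α X₀` (the table and datum carried by `DynamicsLocalAt` itself; ℤ-induction on
the checkpoint level along the restriction of a global pseudo-solution). This file closes the new
item by that theorem.

HONEST FRAMING: bookkeeping about Tao-type MODEL lattice pseudo-flows (Tao 2016 §6.1–6.2); nothing
here is a statement about the Navier–Stokes equations, and the route's rung leaf is not the summit
Statement.
-/

noncomputable section

set_option linter.dupNamespace false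

namespace Summit.NavierStokesRegularity.NavierStokesRegularity.Theorems

open LocalDynamicsSufficesAt in
/-- **Item stmt-NavierStokesRegularity-20652** (`TaoLadderRungTwoPoly.LocalDynamicsSufficesAt`): for
`ε₀ > 0` and `R ≥ 1`, `DynamicsLocalAt ε₀ R` gives `α ∈ InTableClass R` and `X₀` with
`NoGlobalCascade ε₀ α X₀` — the statement of the shared support stmt-NavierStokesRegularity-20426
read in route `TaoLadderRungTwoPoly`, closed by the tree theorem
`LocalDynamicsSufficesAt.noGlobalCascade_of_local`.
[cite: Tao2016AveragedNS, §6.2 p. 32 with §6.1 p. 31] -/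
theorem taoLadderRungTwoPoly_localDynamicsSufficesAt_proof :
    Summit.NavierStokesRegularity.NavierStokesRegularity.Theses.TaoLadderRungTwoPoly.LocalDynamicsSufficesAt := by
  unfold
    Summit.NavierStokesRegularity.NavierStokesRegularity.Theses.TaoLadderRungTwoPoly.LocalDynamicsSufficesAt
  intro ε₀ R hε₀ _hR hdyn
  obtain ⟨θ, c, i₀, α, X₀, P, Q, _hθ0, hθ, hc, hα, hX₀, hP, hstep⟩ := hdyn
  exact ⟨α, X₀, hα, noGlobalCascade_of_local (Q := Q) hε₀ hθ hc hX₀ hP hstep⟩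

end Summit.NavierStokesRegularity.NavierStokesRegularity.Theorems

end
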